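import Literature.MathematicalPhysics.QuantumFieldTheory.Balaban1983to89.B9SectCDiff

/-!
# `Balaban1983to89.B9SectCDiffExpansion` — the intertwining-defect EXPANSION of `Q(G_□ − G_{□₀})Q*` through the
constituents of B9's operators (3.25)–(3.27), as kernel identities (levels (E0)–(E5) of the cell record
`b2b-balaban-r1/SectC-diff-proof.md` §4, THEOREM D)

B9 = T. Bałaban, *Propagators for lattice gauge theories in a background field*, Commun. Math. Phys. **99**, 389–434
(1985) [Balaban1985BackgroundPropagators].

CITATION HEADER (lean-in-tree rule 2026-08-18).  Cell `pub-balaban`, unit `b2b-balaban-r1-g10` (READER GROUP A,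
lineage r1, gen 10), journal claim `SECTC-DIFF-EXPANSION` (second node of the seat; first node `SECTC-DIFF-RESOLVENT`
= tree `…B9SectCDiff`; v1 p182495; v1.1 = journal claim `DOCFIX-B9SECTCDIFF-R12`: HEADER-ONLY completion of the (3.25)
quotation below after the module cross-read GAPS C-adv2-48 (b2b-balaban-adv2-g33) of the sibling — no declaration
changed).  Source B9: doi:10.1007/bf01240355, held `paper:balaban1985-cmp99-background-propagators`, journal page =
PDF page + 388; the quotations below were read from the page renders
`run/shared/lean/pub/pub-balaban/b2b-balaban-ref1/pages/1985-cmp99-background-propagators/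
1985-cmp99-background-propagators-p006-x2.png` (p. 394), `…-p007-x2.png` (p. 395), `…-p024-x2.png` (p. 412),
`…-p026-x2.png` (p. 414) AS IMAGES by this unit (the same renders as for `…B9SectCDiff`).  Cell rows: GAPS G-B9-05
(p. 412: the transfer of [2]'s difference-of-propagators estimate to the local multiscale propagators, asserted),
its repair row G-B9-05R (THEOREM D: derivation modulo named hypotheses; residual (iv) = "the assembled instance is not
typed" — THIS MODULE types its ALGEBRAIC half), C-r1g10-1; INTERFACES-A IF-A-33; DIVERGENCE D-r1g10.1.  Tree input
(by name): `B9SectCDiff.tdef` (the derivation `𝔇(T) = XU·T₂ − T₁·XV`) with `tdef_mul`, `tdef_inv`, `tdef_add`,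
`tdef_sub`, `tdef_one`, `sub_eq_neg_tdef_apply`, `cutX`.

## THE PRINTED TEXT (verbatim)

B9 p. 394–395 [PDF 6–7]: (3.25) *"Rf = (I − G′Q′*(Q′G′²Q′*)⁻¹Q′G′)f, (3.25) where G′ = G′(U) = (Δ′_a)⁻¹."*
(v1.1: the words «where G′ = G′(U) =» restored; XREAD C-adv2-48 R2); (3.26) *"Δ^η_a(U) = Δ^η(U) +
D^η_U R(U) D^{η*}_U + Q*(U)aQ(U)"*; (3.27) *"G(U) = (Δ_a↾Ω₀)⁻¹."*  B9 p. 412 [PDF 24], after (3.97): *"… the differences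
□̃Q′(G′²_{□₀} − G′²_□)Q′*□ can be estimated by the usual factors multiplied by e^{−2δ₀M}. We have to notice only that
the operators may differ outside □̃₀, and the distance from □̃ to □̃₀ᶜ is at least M (on L^{−j}-scale)."*  B9 p. 414
[PDF 26], the third sum of (3.105): *"− Σ_□ ζ_□̃(DPD* − DP_□D*)h_□G_□h_□"* — print's own meeting with the fact that the
projection part `D R D*` of (3.26) is NOT local.

## WHAT THIS MODULE DOES

An ABSTRACT TWO-SEQUENCE OPERATOR SYSTEM (`TwoSeq`): the fine carriers `s` (sites: scalar / 𝔤-valued functions) and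
`b` (bonds: 1-forms) are SHARED by the two local sequences `{Ω_n(□)}` (index 1) and `{Ω_n(□₀)}` (index 2); the coarse
carriers `S_c` (block sites) and `B_c` (block bonds) are per sequence.  Sequence-independent constituents: `D : b × s`
(the covariant gradient ∂ = D^η_U), `Dt : s × b` (∂* = D^{η*}_U), `Λ : b × b` (the local part Δ^η(U) of (3.26)),
`Λ' : s × s` (the local part Δ′ of Δ′_a).  Per sequence: the averaging operators `Q_c : B_c × b`, `Qt_c : b × B_c`,
`Q'_c : S_c × s`, `Q't_c : s × S_c`, the multi-level `a`-terms `A_c : b × b` (= Q*(U)aQ(U) of (3.26)) and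
`A'_c : s × s`, and the inverses `G'_c` (of Δ′_{a,c} := Dt·D + Λ' + A'_c, (3.25)), `C_c` (of E_c := Q'_c G'_c² Q't_c,
invertible by Thm 3.2), `G_c` (of Δ_{a,c} := Λ + A_c + D·R_c·Dt with R_c := 1 − P_c, P_c := G'_c Q't_c C_c Q'_c G'_c,
(3.25)–(3.27)) — the inverse identities being FIELDS (hypotheses), exactly the one-sided ones the inverse rule needs.
Intertwiners (cutoffs) `χs : s × s`, `χb : b × b`, `ψS : S₁ × S₂`, `ψB : B₁ × B₂` are ARBITRARY matrices: every
identity below is exact for any choice (the smooth cutoff of THEOREM D is one choice; its properties matter only for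
the estimates, which are NOT in this module).

THE IDENTITIES (each = one application of the Leibniz / inverse / additivity rules of `B9SectCDiff.tdef`; all terms
written with sequence-1 operators LEFT of the unique defect and sequence-2 operators RIGHT of it):
(E5) `dG'_eq` : 𝔇(G′) = −G′₁·(𝔇(∂*∂) + 𝔇(Λ′) + 𝔇(A′))·G′₂;
(E4) `dE_eq` : 𝔇(Q′G′²Q′*) = 𝔇(Q′)G′₂²Q′*₂ + Q′₁𝔇(G′)G′₂Q′*₂ + Q′₁G′₁𝔇(G′)Q′*₂ + Q′₁G′₁²𝔇(Q′*), `dC_eq` : 𝔇(C) = −C₁𝔇(E)C₂;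
(E3) `dP_eq` : 𝔇(P) = 𝔇(G′)Q′*₂C₂Q′₂G′₂ + G′₁𝔇(Q′*)C₂Q′₂G′₂ + G′₁Q′*₁𝔇(C)Q′₂G′₂ + G′₁Q′*₁C₁𝔇(Q′)G′₂ + G′₁Q′*₁C₁Q′₁𝔇(G′);
(E2) `dR_eq` : 𝔇(R) = −𝔇(P), `ddA_eq` : 𝔇(Δ_a) = 𝔇(Λ) + 𝔇(A) + 𝔇(∂)R₂∂* + ∂𝔇(R)∂* + ∂R₁𝔇(∂*);
(E1) `dG_eq` : 𝔇(G) = −G₁𝔇(Δ_a)G₂;   (E0) `dT_eq` : 𝔇(QGQ*) = 𝔇(Q)G₂Q*₂ + Q₁𝔇(G)Q*₂ + Q₁G₁𝔇(Q*);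
the fully substituted forms `dT_explicit` (nested: 𝔇(QGQ*) as an explicit polynomial in full one-sequence
operators and the ELEVEN local defects 𝔇(Q), 𝔇(Q*), 𝔇(∂), 𝔇(∂*), 𝔇(Λ), 𝔇(A), 𝔇(∂*∂), 𝔇(Λ′), 𝔇(A′), 𝔇(Q′), 𝔇(Q′*) —
22 leaves, each containing EXACTLY ONE defect) and `dT_flat` (the sum of SIXTEEN monomials `L·𝔇(Lc)·R` with
`R_c = 1 − P_c` expanded and `𝔇(Δ′_a)` kept composite — the term list the estimate half consumes, every `∂` left of a
`G′₁`, every `∂*` left of `G₂`), the PLACEMENT regroupings `D_mul_R₁`, `R₂_mul_Dt`, `D_mul_dP`, `dE_explicit` (every term of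
∂·𝔇(P) begins with the product ∂G′₁ — the "derivative on the LEFT of the first G′₁" of the record's placement rule),
and the core-entry corollary `core_entry` (on the core of the cutoffs, (Q₁G₁Q*₁ − Q₂G₂Q*₂)(a,v) = −𝔇(QGQ*)(a,v),
from `B9SectCDiff.sub_eq_neg_tdef_apply`).

It asserts nothing printed beyond the quotations; no `HarnessLib` fact, no named-fact `Prop`.  NOT in this module
(successor item (T1b) of `b2b-balaban-r1/g10/BRIEF-gen11.md`): the ESTIMATE half of THEOREM D — hypotheses (M)
(Thms 3.1–3.3 + (3.48) per sequence, as `Decay` statements), (L) (zone support and O(M⁻¹) size of the eleven defects,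
incl. the one-sided forms of ∂·𝔇(∂*), 𝔇(∂*∂)), (G), (P) ⇒ the (1.12)-`Shape` of the majorant via
`B9SectCDiff.Decay.mul_of_lt_right`, `Shape.zone_sandwich`, `entry_bound_of_window_shape`.  Value = kernel
certificate of located bookkeeping (the term list of THEOREM D is complete and every term carries exactly one local
defect), NOT summit progress.
-/

namespace Literature.MathematicalPhysics.QuantumFieldTheory.Balaban1983to89.B9SectCDiffExpansion

open Matrix
open B9SectCDiff (tdef tdef_def tdef_mul tdef_mul₃ tdef_add tdef_sub tdef_one tdef_inv cutX sub_eq_neg_tdef_apply)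

universe u

/-- An abstract TWO-SEQUENCE system of B9's operators (3.25)–(3.27) with intertwiners: shared fine carriers `s`
(sites), `b` (bonds); coarse carriers `S_c`, `B_c` per sequence; the inverse identities are hypotheses (fields).
No existence is asserted: an instance must supply the matrices AND the proofs. OURS (typing). [folklore] -/
structure TwoSeq (s b S₁ S₂ B₁ B₂ : Type u) [Fintype s] [DecidableEq s] [Fintype b] [DecidableEq b]
    [Fintype S₁] [DecidableEq S₁] [Fintype S₂] [DecidableEq S₂] [Fintype B₁] [Fintype B₂] where
  /-- intertwiner on sites (multiplication by the cutoff χ) -/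
  χs : Matrix s s ℝ
  /-- intertwiner on bonds -/
  χb : Matrix b b ℝ
  /-- intertwiner between the block-site carriers of the two sequences -/
  ψS : Matrix S₁ S₂ ℝ
  /-- intertwiner between the block-bond carriers of the two sequences -/
  ψB : Matrix B₁ B₂ ℝ
  /-- covariant gradient ∂ = D^η_U : scalars → 1-forms (sequence-independent) -/
  D : Matrix b s ℝ
  /-- covariant divergence ∂* = D^{η*}_U (sequence-independent) -/
  Dt : Matrix s b ℝ
  /-- the local part Δ^η(U) of the vector operator (3.26) (sequence-independent) -/
  Λ : Matrix b b ℝ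
  /-- the local part Δ′ of the scalar operator Δ′_a (sequence-independent) -/
  Λ' : Matrix s s ℝ
  /-- vector averaging Q of sequence 1 -/
  Q₁ : Matrix B₁ b ℝ
  /-- vector averaging Q of sequence 2 -/
  Q₂ : Matrix B₂ b ℝ
  /-- its adjoint Q*, sequence 1 -/
  Qt₁ : Matrix b B₁ ℝ
  /-- its adjoint Q*, sequence 2 -/
  Qt₂ : Matrix b B₂ ℝ
  /-- scalar averaging Q′, sequence 1 -/
  Q'₁ : Matrix S₁ s ℝ
  /-- scalar averaging Q′, sequence 2 -/
  Q'₂ : Matrix S₂ s ℝ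
  /-- Q′*, sequence 1 -/
  Q't₁ : Matrix s S₁ ℝ
  /-- Q′*, sequence 2 -/
  Q't₂ : Matrix s S₂ ℝ
  /-- the multi-level term Q*(U)aQ(U) of (3.26), sequence 1 -/
  A₁ : Matrix b b ℝ
  /-- the multi-level term Q*(U)aQ(U) of (3.26), sequence 2 -/
  A₂ : Matrix b b ℝ
  /-- the multi-level term of Δ′_a, sequence 1 -/
  A'₁ : Matrix s s ℝ
  /-- the multi-level term of Δ′_a, sequence 2 -/
  A'₂ : Matrix s s ℝ
  /-- G′ = (Δ′_a)⁻¹ (3.25), sequence 1 -/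
  G'₁ : Matrix s s ℝ
  /-- G′ = (Δ′_a)⁻¹ (3.25), sequence 2 -/
  G'₂ : Matrix s s ℝ
  /-- C = (Q′G′²Q′*)⁻¹ (3.25), sequence 1 -/
  C₁ : Matrix S₁ S₁ ℝ
  /-- C = (Q′G′²Q′*)⁻¹ (3.25), sequence 2 -/
  C₂ : Matrix S₂ S₂ ℝ
  /-- G = (Δ_a)⁻¹ (3.27), sequence 1 -/
  G₁ : Matrix b b ℝ
  /-- G = (Δ_a)⁻¹ (3.27), sequence 2 -/
  G₂ : Matrix b b ℝ
  /-- left inverse: G′₁·Δ′_{a,1} = 1 -/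
  hG'₁ : G'₁ * (Dt * D + Λ' + A'₁) = 1
  /-- right inverse: Δ′_{a,2}·G′₂ = 1 -/
  hG'₂ : (Dt * D + Λ' + A'₂) * G'₂ = 1
  /-- left inverse: C₁·(Q′₁G′₁²Q′*₁) = 1 -/
  hC₁ : C₁ * (Q'₁ * G'₁ * G'₁ * Q't₁) = 1
  /-- right inverse: (Q′₂G′₂²Q′*₂)·C₂ = 1 -/
  hC₂ : (Q'₂ * G'₂ * G'₂ * Q't₂) * C₂ = 1
  /-- left inverse: G₁·Δ_{a,1} = 1, Δ_{a,1} = Λ + A₁ + ∂(1 − P₁)∂* -/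
  hG₁ : G₁ * (Λ + A₁ + D * (1 - G'₁ * Q't₁ * C₁ * Q'₁ * G'₁) * Dt) = 1
  /-- right inverse: Δ_{a,2}·G₂ = 1 -/
  hG₂ : (Λ + A₂ + D * (1 - G'₂ * Q't₂ * C₂ * Q'₂ * G'₂) * Dt) * G₂ = 1

namespace TwoSeq

variable {s b S₁ S₂ B₁ B₂ : Type u} [Fintype s] [DecidableEq s] [Fintype b] [DecidableEq b]
  [Fintype S₁] [DecidableEq S₁] [Fintype S₂] [DecidableEq S₂] [Fintype B₁] [Fintype B₂]
variable (X : TwoSeq s b S₁ S₂ B₁ B₂)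

/-! ### The composite operators (3.25)–(3.27), per sequence -/

/-- Δ′_{a,1} = ∂*∂ + Λ′ + A′₁ (3.25). OURS (typing). [folklore] -/
def dA'₁ : Matrix s s ℝ := X.Dt * X.D + X.Λ' + X.A'₁
/-- Δ′_{a,2}. OURS (typing). [folklore] -/
def dA'₂ : Matrix s s ℝ := X.Dt * X.D + X.Λ' + X.A'₂
/-- E₁ = Q′₁G′₁²Q′*₁ (the operator inverted in (3.25)). OURS (typing). [folklore] -/
def E₁ : Matrix S₁ S₁ ℝ := X.Q'₁ * X.G'₁ * X.G'₁ * X.Q't₁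
/-- E₂ = Q′₂G′₂²Q′*₂. OURS (typing). [folklore] -/
def E₂ : Matrix S₂ S₂ ℝ := X.Q'₂ * X.G'₂ * X.G'₂ * X.Q't₂
/-- P₁ = G′₁Q′*₁C₁Q′₁G′₁ (3.25). OURS (typing). [folklore] -/
def P₁ : Matrix s s ℝ := X.G'₁ * X.Q't₁ * X.C₁ * X.Q'₁ * X.G'₁
/-- P₂. OURS (typing). [folklore] -/
def P₂ : Matrix s s ℝ := X.G'₂ * X.Q't₂ * X.C₂ * X.Q'₂ * X.G'₂
/-- R₁ = 1 − P₁ (3.25). OURS (typing). [folklore] -/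
def R₁ : Matrix s s ℝ := 1 - X.P₁
/-- R₂ = 1 − P₂. OURS (typing). [folklore] -/
def R₂ : Matrix s s ℝ := 1 - X.P₂
/-- Δ_{a,1} = Λ + A₁ + ∂R₁∂* (3.26). OURS (typing). [folklore] -/
def dA₁ : Matrix b b ℝ := X.Λ + X.A₁ + X.D * X.R₁ * X.Dt
/-- Δ_{a,2}. OURS (typing). [folklore] -/
def dA₂ : Matrix b b ℝ := X.Λ + X.A₂ + X.D * X.R₂ * X.Dt
/-- T₁ = Q₁G₁Q*₁ (the operator of (3.131)/(H-diff)). OURS (typing). [folklore] -/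
def T₁ : Matrix B₁ B₁ ℝ := X.Q₁ * X.G₁ * X.Qt₁
/-- T₂ = Q₂G₂Q*₂. OURS (typing). [folklore] -/
def T₂ : Matrix B₂ B₂ ℝ := X.Q₂ * X.G₂ * X.Qt₂

/-- [folklore] -/ theorem G'₁_mul : X.G'₁ * X.dA'₁ = 1 := X.hG'₁
/-- [folklore] -/ theorem mul_G'₂ : X.dA'₂ * X.G'₂ = 1 := X.hG'₂
/-- [folklore] -/ theorem C₁_mul : X.C₁ * X.E₁ = 1 := X.hC₁
/-- [folklore] -/ theorem mul_C₂ : X.E₂ * X.C₂ = 1 := X.hC₂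
/-- [folklore] -/ theorem G₁_mul : X.G₁ * X.dA₁ = 1 := X.hG₁
/-- [folklore] -/ theorem mul_G₂ : X.dA₂ * X.G₂ = 1 := X.hG₂

/-! ### The eleven LOCAL defects (the `(L)` objects of THEOREM D) and the composite defects -/

/-- 𝔇(Q) : B₁ × b. OURS (typing). [folklore] -/
def dQ : Matrix B₁ b ℝ := tdef X.ψB X.χb X.Q₁ X.Q₂
/-- 𝔇(Q*) : b × B₂. OURS (typing). [folklore] -/
def dQt : Matrix b B₂ ℝ := tdef X.χb X.ψB X.Qt₁ X.Qt₂
/-- 𝔇(∂) : b × s. OURS (typing). [folklore] -/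
def dD : Matrix b s ℝ := tdef X.χb X.χs X.D X.D
/-- 𝔇(∂*) : s × b. OURS (typing). [folklore] -/
def dDt : Matrix s b ℝ := tdef X.χs X.χb X.Dt X.Dt
/-- 𝔇(Λ) : b × b. OURS (typing). [folklore] -/
def dΛ : Matrix b b ℝ := tdef X.χb X.χb X.Λ X.Λ
/-- 𝔇(A) = 𝔇(Q*aQ) : b × b. OURS (typing). [folklore] -/
def dA : Matrix b b ℝ := tdef X.χb X.χb X.A₁ X.A₂
/-- 𝔇(∂*∂) : s × s (kept whole; its one-sided forms belong to the estimates). OURS (typing). [folklore] -/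
def dDtD : Matrix s s ℝ := tdef X.χs X.χs (X.Dt * X.D) (X.Dt * X.D)
/-- 𝔇(Λ′) : s × s. OURS (typing). [folklore] -/
def dΛ' : Matrix s s ℝ := tdef X.χs X.χs X.Λ' X.Λ'
/-- 𝔇(A′) : s × s. OURS (typing). [folklore] -/
def dA' : Matrix s s ℝ := tdef X.χs X.χs X.A'₁ X.A'₂
/-- 𝔇(Q′) : S₁ × s. OURS (typing). [folklore] -/
def dQ' : Matrix S₁ s ℝ := tdef X.ψS X.χs X.Q'₁ X.Q'₂
/-- 𝔇(Q′*) : s × S₂. OURS (typing). [folklore] -/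
def dQ't : Matrix s S₂ ℝ := tdef X.χs X.ψS X.Q't₁ X.Q't₂
/-- 𝔇(Δ′_a) : s × s. OURS (typing). [folklore] -/
def ddA' : Matrix s s ℝ := tdef X.χs X.χs X.dA'₁ X.dA'₂
/-- 𝔇(G′) : s × s. OURS (typing). [folklore] -/
def dG' : Matrix s s ℝ := tdef X.χs X.χs X.G'₁ X.G'₂
/-- 𝔇(E) : S₁ × S₂. OURS (typing). [folklore] -/
def dE : Matrix S₁ S₂ ℝ := tdef X.ψS X.ψS X.E₁ X.E₂
/-- 𝔇(C) : S₁ × S₂. OURS (typing). [folklore] -/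
def dC : Matrix S₁ S₂ ℝ := tdef X.ψS X.ψS X.C₁ X.C₂
/-- 𝔇(P) : s × s. OURS (typing). [folklore] -/
def dP : Matrix s s ℝ := tdef X.χs X.χs X.P₁ X.P₂
/-- 𝔇(R) : s × s. OURS (typing). [folklore] -/
def dR : Matrix s s ℝ := tdef X.χs X.χs X.R₁ X.R₂
/-- 𝔇(Δ_a) : b × b. OURS (typing). [folklore] -/
def ddA : Matrix b b ℝ := tdef X.χb X.χb X.dA₁ X.dA₂
/-- 𝔇(G) : b × b. OURS (typing). [folklore] -/
def dG : Matrix b b ℝ := tdef X.χb X.χb X.G₁ X.G₂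
/-- 𝔇(QGQ*) : B₁ × B₂ — the object of (H-diff). OURS (typing). [folklore] -/
def dT : Matrix B₁ B₂ ℝ := tdef X.ψB X.ψB X.T₁ X.T₂

/-! ### (E5) the scalar propagator G′ -/

/-- `𝔇(Δ′_a) = 𝔇(∂*∂) + 𝔇(Λ′) + 𝔇(A′)` — additivity. [folklore] -/
theorem ddA'_eq : X.ddA' = X.dDtD + X.dΛ' + X.dA' := by
  simp only [ddA', dA'₁, dA'₂, dDtD, dΛ', dA', tdef_add]

/-- (E5) `𝔇(G′) = −G′₁·(𝔇(∂*∂) + 𝔇(Λ′) + 𝔇(A′))·G′₂` — the inverse rule for (3.25) `G′ = (Δ′_a)⁻¹`. [folklore] -/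
theorem dG'_eq : X.dG' = -(X.G'₁ * (X.dDtD + X.dΛ' + X.dA') * X.G'₂) := by
  rw [← ddA'_eq, dG', ddA']
  exact tdef_inv X.χs X.χs X.G'₁_mul X.mul_G'₂

/-- (E5′) the same with the composite local defect `𝔇(Δ′_a)` kept whole: `𝔇(G′) = −G′₁·𝔇(Δ′_a)·G′₂`. [folklore] -/
theorem dG'_eq' : X.dG' = -(X.G'₁ * X.ddA' * X.G'₂) := by
  rw [ddA'_eq]; exact X.dG'_eq

/-! ### (E4) the operator E = Q′G′²Q′* and its inverse C -/

/-- (E4a) `𝔇(Q′G′²Q′*) = 𝔇(Q′)G′₂²Q′*₂ + Q′₁𝔇(G′)G′₂Q′*₂ + Q′₁G′₁𝔇(G′)Q′*₂ + Q′₁G′₁²𝔇(Q′*)` — Leibniz. [folklore] -/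
theorem dE_eq : X.dE = X.dQ' * X.G'₂ * X.G'₂ * X.Q't₂ + X.Q'₁ * X.dG' * X.G'₂ * X.Q't₂
    + X.Q'₁ * X.G'₁ * X.dG' * X.Q't₂ + X.Q'₁ * X.G'₁ * X.G'₁ * X.dQ't := by
  simp only [dE, E₁, E₂, dQ', dG', dQ't, tdef, Matrix.mul_sub, Matrix.sub_mul, Matrix.mul_assoc]
  abel

/-- (E4b) `𝔇(C) = −C₁·𝔇(Q′G′²Q′*)·C₂` — the inverse rule for `C = (Q′G′²Q′*)⁻¹` (Thm 3.2). [folklore] -/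
theorem dC_eq : X.dC = -(X.C₁ * X.dE * X.C₂) := by
  rw [dC, dE]
  exact tdef_inv X.ψS X.ψS X.C₁_mul X.mul_C₂

/-! ### (E3) the projection P = G′Q′*CQ′G′ -/

/-- (E3) `𝔇(P) = 𝔇(G′)Q′*₂C₂Q′₂G′₂ + G′₁𝔇(Q′*)C₂Q′₂G′₂ + G′₁Q′*₁𝔇(C)Q′₂G′₂ + G′₁Q′*₁C₁𝔇(Q′)G′₂ + G′₁Q′*₁C₁Q′₁𝔇(G′)`
— Leibniz for the five-fold product (3.25). [folklore] -/
theorem dP_eq : X.dP = X.dG' * X.Q't₂ * X.C₂ * X.Q'₂ * X.G'₂ + X.G'₁ * X.dQ't * X.C₂ * X.Q'₂ * X.G'₂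
    + X.G'₁ * X.Q't₁ * X.dC * X.Q'₂ * X.G'₂ + X.G'₁ * X.Q't₁ * X.C₁ * X.dQ' * X.G'₂
    + X.G'₁ * X.Q't₁ * X.C₁ * X.Q'₁ * X.dG' := by
  simp only [dP, P₁, P₂, dG', dQ't, dC, dQ', tdef, Matrix.mul_sub, Matrix.sub_mul, Matrix.mul_assoc]
  abel

/-! ### (E2) R = 1 − P and the vector operator Δ_a = Λ + A + ∂R∂* -/

/-- (E2a) `𝔇(R) = −𝔇(P)` (since `𝔇(1) = χ − χ = 0` on the shared site carrier). [folklore] -/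
theorem dR_eq : X.dR = -X.dP := by
  rw [dR, dP, R₁, R₂, tdef_sub, tdef_one, zero_sub]

/-- (E2b) `𝔇(Δ_a) = 𝔇(Λ) + 𝔇(A) + 𝔇(∂)R₂∂* + ∂𝔇(R)∂* + ∂R₁𝔇(∂*)` — additivity + Leibniz for (3.26). [folklore] -/
theorem ddA_eq : X.ddA = X.dΛ + X.dA + X.dD * X.R₂ * X.Dt + X.D * X.dR * X.Dt + X.D * X.R₁ * X.dDt := by
  simp only [ddA, dA₁, dA₂, dΛ, dA, dD, dR, dDt, tdef, Matrix.mul_sub, Matrix.sub_mul, Matrix.mul_add,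
    Matrix.add_mul, Matrix.mul_assoc]
  abel

/-- (E2c) the same with `𝔇(R) = −𝔇(P)` substituted. [folklore] -/
theorem ddA_eq' : X.ddA = X.dΛ + X.dA + X.dD * X.R₂ * X.Dt - X.D * X.dP * X.Dt + X.D * X.R₁ * X.dDt := by
  rw [ddA_eq, dR_eq, Matrix.mul_neg, Matrix.neg_mul, ← sub_eq_add_neg]

/-! ### (E1) the vector propagator G = Δ_a⁻¹ and (E0) the target QGQ* -/

/-- (E1) `𝔇(G) = −G₁·𝔇(Δ_a)·G₂` — the inverse rule for (3.27). [folklore] -/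
theorem dG_eq : X.dG = -(X.G₁ * X.ddA * X.G₂) := by
  rw [dG, ddA]
  exact tdef_inv X.χb X.χb X.G₁_mul X.mul_G₂

/-- (E0) `𝔇(QGQ*) = 𝔇(Q)G₂Q*₂ + Q₁𝔇(G)Q*₂ + Q₁G₁𝔇(Q*)` — Leibniz. [folklore] -/
theorem dT_eq : X.dT = X.dQ * X.G₂ * X.Qt₂ + X.Q₁ * X.dG * X.Qt₂ + X.Q₁ * X.G₁ * X.dQt := by
  simp only [dT, T₁, T₂, dQ, dG, dQt, tdef, Matrix.mul_sub, Matrix.sub_mul, Matrix.mul_assoc]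
  abel

/-! ### The fully substituted expansion: 22 monomials, each with EXACTLY ONE of the eleven local defects -/

/-- THEOREM D, algebraic half: `𝔇(QGQ*)` as an explicit polynomial in the full one-sequence operators
`Q_c, Q*_c, G_c, ∂, ∂*, R_c, G′_c, Q′_c, Q′*_c, C_c` and the eleven local defects, sequence-1 factors LEFT of the
defect and sequence-2 factors RIGHT of it; obtained by substituting (E5) → (E4) → (E3) → (E2) → (E1) → (E0).
Term count: 2 (𝔇(Q), 𝔇(Q*)) + 2 (𝔇(Λ), 𝔇(A)) + 2 (𝔇(∂), 𝔇(∂*)) + [𝔇(P): 2×3 (𝔇(G′) twice) + 2 (𝔇(Q′*), 𝔇(Q′))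
+ 𝔇(C): 2 (𝔇(Q′), 𝔇(Q′*)) + 2×3 (𝔇(G′) twice)] = 22. [folklore] -/
theorem dT_explicit : X.dT =
    X.dQ * X.G₂ * X.Qt₂ + X.Q₁ * X.G₁ * X.dQt
    - X.Q₁ * (X.G₁ * (X.dΛ + X.dA + X.dD * X.R₂ * X.Dt
        - X.D * (-(X.G'₁ * (X.dDtD + X.dΛ' + X.dA') * X.G'₂) * X.Q't₂ * X.C₂ * X.Q'₂ * X.G'₂
                 + X.G'₁ * X.dQ't * X.C₂ * X.Q'₂ * X.G'₂
                 + X.G'₁ * X.Q't₁ * (-(X.C₁ * (X.dQ' * X.G'₂ * X.G'₂ * X.Q't₂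
                     + X.Q'₁ * (-(X.G'₁ * (X.dDtD + X.dΛ' + X.dA') * X.G'₂)) * X.G'₂ * X.Q't₂
                     + X.Q'₁ * X.G'₁ * (-(X.G'₁ * (X.dDtD + X.dΛ' + X.dA') * X.G'₂)) * X.Q't₂
                     + X.Q'₁ * X.G'₁ * X.G'₁ * X.dQ't) * X.C₂)) * X.Q'₂ * X.G'₂
                 + X.G'₁ * X.Q't₁ * X.C₁ * X.dQ' * X.G'₂
                 + X.G'₁ * X.Q't₁ * X.C₁ * X.Q'₁ * (-(X.G'₁ * (X.dDtD + X.dΛ' + X.dA') * X.G'₂))) * X.Dt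
        + X.D * X.R₁ * X.dDt) * X.G₂) * X.Qt₂ := by
  rw [dT_eq, dG_eq, ddA_eq', dP_eq, dC_eq, dE_eq, dG'_eq]
  simp only [Matrix.mul_neg, Matrix.neg_mul, Matrix.mul_assoc]
  abel

/-- THEOREM D, algebraic half, FLAT FORM — the term list of the record's COUNT paragraph: `𝔇(QGQ*)` = the sum of
SIXTEEN monomials `L · 𝔇(Lc) · R`, each with exactly ONE local defect `𝔇(Lc) ∈ {𝔇(Q), 𝔇(Q*), 𝔇(Λ), 𝔇(A), 𝔇(∂),
∂·𝔇(∂*), 𝔇(∂*), 𝔇(Q′*), 𝔇(Q′), 𝔇(Δ′_a)}` (`𝔇(Δ′_a) = 𝔇(∂*∂) + 𝔇(Λ′) + 𝔇(A′)` composite-local, `ddA'_eq`; splitting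
it gives 24) between a product `L` of sequence-1 operators and a product `R` of sequence-2 operators, with `R_c = 1 − P_c`
expanded (`D_mul_R₁`, `R₂_mul_Dt`) so that every `∂` stands immediately LEFT of a `G′₁` and every `∂*` immediately
LEFT of `G₂` (the record's PLACEMENT RULE; the one remaining `∂·𝔇(∂*)` is the multiplication-type pair resolved by
the Leibniz rule (3.100) at the estimate level).  Longest monomial: 7 + 1 + 8 = 16 factors. [folklore] -/
theorem dT_flat : X.dT =
    X.dQ * (X.G₂ * X.Qt₂)
    + (X.Q₁ * X.G₁) * X.dQt
    - (X.Q₁ * X.G₁) * X.dΛ * (X.G₂ * X.Qt₂)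
    - (X.Q₁ * X.G₁) * X.dA * (X.G₂ * X.Qt₂)
    - (X.Q₁ * X.G₁) * X.dD * (X.Dt * X.G₂ * X.Qt₂)
    + (X.Q₁ * X.G₁) * X.dD * (X.G'₂ * X.Q't₂ * X.C₂ * X.Q'₂ * X.G'₂ * (X.Dt * X.G₂) * X.Qt₂)
    - (X.Q₁ * X.G₁) * (X.D * X.dDt) * (X.G₂ * X.Qt₂)
    + (X.Q₁ * X.G₁ * (X.D * X.G'₁) * X.Q't₁ * X.C₁ * X.Q'₁ * X.G'₁) * X.dDt * (X.G₂ * X.Qt₂)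
    - (X.Q₁ * X.G₁ * (X.D * X.G'₁)) * X.ddA' * (X.G'₂ * X.Q't₂ * X.C₂ * X.Q'₂ * X.G'₂ * (X.Dt * X.G₂) * X.Qt₂)
    + (X.Q₁ * X.G₁ * (X.D * X.G'₁)) * X.dQ't * (X.C₂ * X.Q'₂ * X.G'₂ * (X.Dt * X.G₂) * X.Qt₂)
    - (X.Q₁ * X.G₁ * (X.D * X.G'₁) * X.Q't₁ * X.C₁) * X.dQ'
        * (X.G'₂ * X.G'₂ * X.Q't₂ * X.C₂ * X.Q'₂ * X.G'₂ * (X.Dt * X.G₂) * X.Qt₂)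
    + (X.Q₁ * X.G₁ * (X.D * X.G'₁) * X.Q't₁ * X.C₁ * X.Q'₁ * X.G'₁) * X.ddA'
        * (X.G'₂ * X.G'₂ * X.Q't₂ * X.C₂ * X.Q'₂ * X.G'₂ * (X.Dt * X.G₂) * X.Qt₂)
    + (X.Q₁ * X.G₁ * (X.D * X.G'₁) * X.Q't₁ * X.C₁ * X.Q'₁ * X.G'₁ * X.G'₁) * X.ddA'
        * (X.G'₂ * X.Q't₂ * X.C₂ * X.Q'₂ * X.G'₂ * (X.Dt * X.G₂) * X.Qt₂)
    - (X.Q₁ * X.G₁ * (X.D * X.G'₁) * X.Q't₁ * X.C₁ * X.Q'₁ * X.G'₁ * X.G'₁) * X.dQ't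
        * (X.C₂ * X.Q'₂ * X.G'₂ * (X.Dt * X.G₂) * X.Qt₂)
    + (X.Q₁ * X.G₁ * (X.D * X.G'₁) * X.Q't₁ * X.C₁) * X.dQ' * (X.G'₂ * (X.Dt * X.G₂) * X.Qt₂)
    - (X.Q₁ * X.G₁ * (X.D * X.G'₁) * X.Q't₁ * X.C₁ * X.Q'₁ * X.G'₁) * X.ddA' * (X.G'₂ * (X.Dt * X.G₂) * X.Qt₂) := by
  rw [dT_eq, dG_eq, ddA_eq', dP_eq, dC_eq, dE_eq, dG'_eq']
  simp only [R₁, R₂, P₁, P₂, Matrix.mul_add, Matrix.add_mul, Matrix.mul_sub, Matrix.sub_mul, Matrix.mul_neg,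
    Matrix.neg_mul, Matrix.mul_one, Matrix.mul_assoc]
  abel

/-! ### PLACEMENT regroupings (record §4, DERIVATIVE PLACEMENT): the bare `∂` on the left of `𝔇(R)∂*` and of
`R₁𝔇(∂*)` is absorbed by the FIRST `G′₁` of each term — every term of `∂·𝔇(P)` begins with `∂G′₁`, and
`∂R₁ = ∂ − (∂G′₁)Q′*₁C₁Q′₁G′₁`; symmetrically `R₂∂* = ∂* − G′₂Q′*₂C₂Q′₂(G′₂∂*)`. -/

/-- `∂R₁ = ∂ − (∂G′₁)·Q′*₁C₁Q′₁G′₁`. [folklore] -/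
theorem D_mul_R₁ : X.D * X.R₁ = X.D - X.D * X.G'₁ * (X.Q't₁ * X.C₁ * X.Q'₁ * X.G'₁) := by
  simp only [R₁, P₁, Matrix.mul_sub, Matrix.mul_one, Matrix.mul_assoc]

/-- `R₂∂* = ∂* − G′₂Q′*₂C₂Q′₂·(G′₂∂*)`. [folklore] -/
theorem R₂_mul_Dt : X.R₂ * X.Dt = X.Dt - (X.G'₂ * X.Q't₂ * X.C₂ * X.Q'₂) * (X.G'₂ * X.Dt) := by
  simp only [R₂, P₂, Matrix.sub_mul, Matrix.one_mul, Matrix.mul_assoc]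

/-- `∂·𝔇(P) = (∂G′₁)·[ −(𝔇(∂*∂)+𝔇(Λ′)+𝔇(A′))G′₂Q′*₂C₂Q′₂G′₂ + 𝔇(Q′*)C₂Q′₂G′₂ + Q′*₁𝔇(C)Q′₂G′₂ + Q′*₁C₁𝔇(Q′)G′₂
− Q′*₁C₁Q′₁G′₁(𝔇(∂*∂)+𝔇(Λ′)+𝔇(A′))G′₂ ]` — every term of `∂𝔇(P)` carries the derivative on the LEFT of the first
`G′₁` (entry 2 of Thm 3.1 for sequence 1), none on the right of a propagator. [folklore] -/
theorem D_mul_dP : X.D * X.dP = X.D * X.G'₁ *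
    (-((X.dDtD + X.dΛ' + X.dA') * X.G'₂ * X.Q't₂ * X.C₂ * X.Q'₂ * X.G'₂) + X.dQ't * X.C₂ * X.Q'₂ * X.G'₂
      + X.Q't₁ * X.dC * X.Q'₂ * X.G'₂ + X.Q't₁ * X.C₁ * X.dQ' * X.G'₂
      - X.Q't₁ * X.C₁ * X.Q'₁ * X.G'₁ * (X.dDtD + X.dΛ' + X.dA') * X.G'₂) := by
  rw [dP_eq, dG'_eq]
  simp only [Matrix.mul_add, Matrix.add_mul, Matrix.mul_sub, Matrix.mul_neg, Matrix.neg_mul, Matrix.mul_assoc]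
  abel

/-- The same inside `𝔇(C)`'s expansion: `𝔇(E) = 𝔇(Q′)G′₂²Q′*₂ − Q′₁G′₁(𝔇Δ′)G′₂²Q′*₂ − Q′₁G′₁G′₁(𝔇Δ′)G′₂Q′*₂ + Q′₁G′₁²𝔇(Q′*)`
with `𝔇Δ′ := 𝔇(∂*∂)+𝔇(Λ′)+𝔇(A′)` — no bare derivative occurs at this level. [folklore] -/
theorem dE_explicit : X.dE = X.dQ' * X.G'₂ * X.G'₂ * X.Q't₂
    - X.Q'₁ * X.G'₁ * (X.dDtD + X.dΛ' + X.dA') * X.G'₂ * X.G'₂ * X.Q't₂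
    - X.Q'₁ * X.G'₁ * X.G'₁ * (X.dDtD + X.dΛ' + X.dA') * X.G'₂ * X.Q't₂
    + X.Q'₁ * X.G'₁ * X.G'₁ * X.dQ't := by
  rw [dE_eq, dG'_eq]
  simp only [Matrix.mul_neg, Matrix.neg_mul, Matrix.mul_assoc]
  abel

/-! ### The core entry: on the core of the block-bond cutoff the defect IS the difference (H-diff) asks for -/

/-- With `ψB = cutX f₁ f₂ ψ` (a cutoff `ψ` on a common window `mB` of block bonds of the two sequences, embedded by
`f_c : mB → B_c`): on the core `ψ(a) = ψ(v) = 1`, `(Q₁G₁Q*₁)(a,v) − (Q₂G₂Q*₂)(a,v) = −𝔇(QGQ*)(a,v)` — exact, so the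
(H-diff) entry is read off `dT_explicit`. [folklore] -/
theorem core_entry [DecidableEq B₁] [DecidableEq B₂] {mB : Type u} [Fintype mB] {f₁ : mB → B₁} {f₂ : mB → B₂}
    (hf₁ : Function.Injective f₁) (hf₂ : Function.Injective f₂) {ψ : mB → ℝ} (hψ : X.ψB = cutX f₁ f₂ ψ)
    {a v : mB} (ha : ψ a = 1) (hv : ψ v = 1) :
    X.T₁ (f₁ a) (f₁ v) - X.T₂ (f₂ a) (f₂ v) = -(X.dT (f₁ a) (f₂ v)) := by
  rw [dT, hψ]
  exact sub_eq_neg_tdef_apply hf₁ hf₂ X.T₁ X.T₂ ha hv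

end TwoSeq

end Literature.MathematicalPhysics.QuantumFieldTheory.Balaban1983to89.B9SectCDiffExpansion
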